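import Literature.MathematicalPhysics.QuantumLattice.HubbardGridPropagatorGram
import Literature.MathematicalPhysics.QuantumLattice.GrassmannDeterminantBounded
import HarnessLib

/-!
# The Gram constant of a pulled-back normal covariance on the grid fields is the phase-space MASS of its symbol

Topic `MathematicalPhysics/QuantumLattice`; companion of `HubbardGridPropagatorGram` (Gram vectors `gridGramF/G` of
`Sᵀ·normalCovariance p·S` for the grid fields `S = gridSubMatrix L M β x τ`, `‖F_X‖² = ‖G_Y‖² = (βL²)⁻² Σ_k ‖p(k,σ)‖`) and of
`HubbardGridSliceGram` (the SUP × COUNT form of that sum, adequate for a single-scale slice).  For a SOFT line — a symbol with an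
integrable singularity at the Fermi surface and no lower cutoff, e.g. `φ·βL²(iω + e_K)/(ω² + e_K²)` with `0 ≤ φ ≤ 1 − w^K_Λ` — the sup is
thermal (`∝ β`) while the mass `(βL²)⁻¹Σ φ/√(ω² + e_K²)` is `O(Λ)` uniformly in `β`; so the Gram constant is read off the mass directly
(Benfatto–Giuliani–Mastropietro 2006, (2.80): `C(x,y) = ⟨F_x, G_y⟩`, `‖F‖² = ∫|ĝ|`):

* **`isGramBoundedR_gridSub_pullback_normalCovariance_of_mass_le`** — if `(βL²)⁻² Σ_k ‖p(k,σ)‖ ≤ κ²` for both spins (`0 ≤ κ`), then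
  `IsGramBoundedR (Sᵀ·normalCovariance L M p·S) κ` for EVERY finite family of grid points (`gridSubMatrix L M β x τ`), in particular for
  the uniform time grid `hubbardGridSub` (`isGramBoundedR_hubbardGridSub_pullback_normalCovariance_of_mass_le`).

Everything is proved; no definitions, no named facts.

## Sources

G. Benfatto, A. Giuliani, V. Mastropietro, Ann. Henri Poincaré 7 (2006) 809–898, §2.8 (2.80) [`BenfattoGiulianiMastropietro2006`];
W. de Siqueira Pedra, M. Salmhofer, Comm. Math. Phys. 282 (2008) 797–818, Thm 1.3 [`PedraSalmhofer2008`].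
-/

noncomputable section

namespace Literature.MathematicalPhysics.QuantumLattice

open Literature.Probability.LatticeModels GrassmannAlgebra Finset
open scoped InnerProductSpace

variable {L M : ℕ} [NeZero L] {P : Type*}

/-- Equal charge flags mean equal charges. [folklore] -/
private theorem charge_eq_of_decide_eq_m {X Y : GridLeg P} (hq : decide (X.2 = 0) = decide (Y.2 = 0)) : X.2 = Y.2 := by
  rcases Fin.exists_fin_two.1 ⟨X.2, rfl⟩ with hX | hX <;> rcases Fin.exists_fin_two.1 ⟨Y.2, rfl⟩ with hY | hY <;> simp_all

/-- A false charge flag is charge `1`. [folklore] -/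
private theorem charge_eq_one_of_decide_m {Y : GridLeg P} (h : decide (Y.2 = 0) = false) : Y.2 = 1 := by
  rcases Fin.exists_fin_two.1 ⟨Y.2, rfl⟩ with hY | hY <;> simp_all

/-- **The Gram constant of a pulled-back normal covariance is the phase-space mass of its symbol**: for any finite family of grid
points (`x : P → 𝕋_L²`, `τ : P → ℝ`), any symbol `p` and `0 ≤ κ` with `(βL²)⁻² Σ_k ‖p(k,σ)‖ ≤ κ²` for both spins `σ`,
`IsGramBoundedR (Sᵀ·normalCovariance L M p·S) κ`, `S = gridSubMatrix L M β x τ` (charge-`0` legs as rows; Gram vectors `gridGramF/G`).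
[cite: BenfattoGiulianiMastropietro2006, §2.8 (2.80)] -/
theorem isGramBoundedR_gridSub_pullback_normalCovariance_of_mass_le [Fintype P] [DecidableEq P] (β : ℝ) (x : P → TorusSite 2 L)
    (τ : P → ℝ) (p : FreqMomentum L M × Fin 2 → ℂ) {κ : ℝ} (hκ : 0 ≤ κ)
    (hp : ∀ σ : Fin 2, ∑ k : FreqMomentum L M, ‖((1 / (β * (L : ℝ) ^ 2) : ℝ) : ℂ)‖ ^ 2 * ‖p (k, σ)‖ ≤ κ ^ 2) :
    IsGramBoundedR ((gridSubMatrix L M β x τ).transpose * normalCovariance L M p * gridSubMatrix L M β x τ) κ := by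
  have hF : ∀ X : GridLeg P, ‖gridGramF L M β x τ p X‖ ≤ κ := fun X =>
    (pow_le_pow_iff_left₀ (norm_nonneg _) hκ two_ne_zero).1 (by rw [norm_sq_gridGramF]; exact hp X.1.2)
  have hG : ∀ Y : GridLeg P, ‖gridGramG L M β x τ p Y‖ ≤ κ := fun Y =>
    (pow_le_pow_iff_left₀ (norm_nonneg _) hκ two_ne_zero).1 (by rw [norm_sq_gridGramG]; exact hp Y.1.2)
  exact isGramBoundedR_of_gram (fun X : GridLeg P => decide (X.2 = 0)) _
    (fun X Y h => gridSub_pullback_normalCovariance_apply_of_charge_eq β _ _ p (charge_eq_of_decide_eq_m h))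
    (gridGramF L M β x τ p) (gridGramG L M β x τ p) hκ (fun X _ => hF X) (fun Y _ => hG Y)
    (fun X Y hX hY => contr_gridSub_pullback_normalCovariance_eq_inner β _ _ p (by simpa using hX) (charge_eq_one_of_decide_m hY))

/-- **The same on the uniform `N`-point time grid** (`hubbardGridSub L M β N`). [cite: BenfattoGiulianiMastropietro2006, §2.8 (2.80)] -/
theorem isGramBoundedR_hubbardGridSub_pullback_normalCovariance_of_mass_le (β : ℝ) (N : ℕ) (p : FreqMomentum L M × Fin 2 → ℂ)
    {κ : ℝ} (hκ : 0 ≤ κ)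
    (hp : ∀ σ : Fin 2, ∑ k : FreqMomentum L M, ‖((1 / (β * (L : ℝ) ^ 2) : ℝ) : ℂ)‖ ^ 2 * ‖p (k, σ)‖ ≤ κ ^ 2) :
    IsGramBoundedR ((hubbardGridSub L M β N).transpose * normalCovariance L M p * hubbardGridSub L M β N) κ := by
  rw [hubbardGridSub]
  exact isGramBoundedR_gridSub_pullback_normalCovariance_of_mass_le β _ _ p hκ hp

end Literature.MathematicalPhysics.QuantumLattice

end
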